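import Mathlib
import HarnessLib
import Summits.HubbardSuperconductivity.HubbardSuperconductivity.Theorems.KLProgrammeCutCurrencyFirstMoment

/-!
# Route `KLProgramme` — ENGINE (stmt-HubbardSuperconductivity-20437 `KLRegimeEngineV17F2`), located #25 «(b)-PLAIN-UV-TAIL», cure (α),
# E1 item (i) towards the WEIGHTED rows: the discrete first-moment lemma and the β/M-explicit FIRST TIME MOMENT of the cut leg kernel
# (cell gate-hubbard-kl, seat hubbard-kl-k3c2-p2 g35)

* `klct_sum_dist_mul_le_of_cube_decay` — the discrete first-moment lemma on `ℤ_N`: `h ≤ S`, `h·dist³ ≤ K` ⇒ `Σ_j dist(j)·h(j) ≤ S·J(J+1) + 2K/J` (`J ≥ 1`);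
* **`klct_legFirstMoment_uvCut_le`** — for `128 ≤ β ≤ M` and every `J ≥ 1`, the physical first time moment of one cut leg
  `(2M)⁻¹ Σ_j (β·min(j,2M−j)/(2M))·|ĉ(j)| ≤ β·[(β/(8π)+1)·J(J+1) + 2·(C₃(β)(2M)³/64)/J]/(2M)²`, `C₃(β) = 4K₃(2π/β)³(3β/(64π)+4)`
  (`…FirstMoment`: cubic pointwise decay; `…LegMass`: support count) — β/M-free for `J ≍ M·(C₃/S)^{1/3}`; the numeric corollary and the
  `klScaleWt` plumbing are the weighted-row file's.
No definition; nothing asserts any row, (b), (C), K3, U₀, the window or superconductivity.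
References: BGM 2006 §2.2–2.3 [cite: BenfattoGiulianiMastropietro2006].
-/

noncomputable section

namespace Summit.HubbardSuperconductivity.HubbardSuperconductivity.Theorems.KLRegimeSplit

set_option linter.dupNamespace false -- summit = problem name (single-conjunct summit), D-0017

open Finset Literature.MathematicalPhysics.QuantumLattice

variable {M : ℕ} [NeZero M]

/-! ## §4 The discrete first-moment lemma -/

omit [NeZero M] in
/-- **THE DISCRETE FIRST-MOMENT LEMMA.**  `h ≤ S` on `ℤ_N` (`0 ≤ S`) and `h(j)·min(j, N−j)³ ≤ K` for `j ≠ 0` (`0 ≤ K`) imply, for every `J ≥ 1`,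
`Σ_j min(j, N−j)·h(j) ≤ S·J(J+1) + 2K/J` (near part: `Σ_{d ≤ J} d` on both sides; far part: `h·d ≤ K/d²` and `Σ_{d > J} d⁻² ≤ 1/J`). -/
theorem klct_sum_dist_mul_le_of_cube_decay {N : ℕ} (h : Fin N → ℝ) {S K : ℝ} (hS : 0 ≤ S) (hK : 0 ≤ K) (hle : ∀ j, h j ≤ S)
    (hdec : ∀ j : Fin N, (j : ℕ) ≠ 0 → h j * (min (j : ℝ) ((N : ℝ) - j)) ^ 3 ≤ K) {J : ℕ} (hJ : 1 ≤ J) :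
    ∑ j : Fin N, min (j : ℝ) ((N : ℝ) - j) * h j ≤ S * (J * (J + 1)) + 2 * K / J := by
  classical
  set h' : ℕ → ℝ := fun v => if hv : v < N then h ⟨v, hv⟩ else 0 with hh'
  have hsum : ∑ j : Fin N, min (j : ℝ) ((N : ℝ) - j) * h j = ∑ v ∈ range N, min (v : ℝ) ((N : ℝ) - v) * h' v := by
    rw [← Fin.sum_univ_eq_sum_range]
    exact Finset.sum_congr rfl (fun j _ => by simp [hh', j.isLt])
  rw [hsum]
  set b : ℕ → ℝ := fun v => (if v ≤ J then (v : ℝ) * S else 0) + (if N ≤ v + J then (((N - v : ℕ) : ℝ)) * S else 0) +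
      K * (if J < v then ((v : ℝ) ^ 2)⁻¹ else 0) + K * (if J < N - v then (((N - v : ℕ) : ℝ) ^ 2)⁻¹ else 0) with hb
  have hpt : ∀ v ∈ range N, min (v : ℝ) ((N : ℝ) - v) * h' v ≤ b v := by
    intro v hv
    have hvN : v < N := Finset.mem_range.mp hv
    have hv' : h' v = h ⟨v, hvN⟩ := by simp [hh', hvN]
    rw [hv']
    have hNv : ((N - v : ℕ) : ℝ) = (N : ℝ) - v := by rw [Nat.cast_sub hvN.le]
    have hmv : min (v : ℝ) ((N : ℝ) - v) ≤ v := min_le_left _ _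
    have hmN : min (v : ℝ) ((N : ℝ) - v) ≤ (N : ℝ) - v := min_le_right _ _
    have hvR : ((v : ℕ) : ℝ) < N := by exact_mod_cast hvN
    have hm0 : 0 ≤ min (v : ℝ) ((N : ℝ) - v) := le_min (by positivity) (by linarith)
    have hhS := hle ⟨v, hvN⟩
    have t1 : 0 ≤ (if v ≤ J then (v : ℝ) * S else 0) := by split_ifs <;> positivity
    have t2 : 0 ≤ (if N ≤ v + J then (((N - v : ℕ) : ℝ)) * S else 0) := by split_ifs <;> positivity
    have t3 : 0 ≤ K * (if J < v then ((v : ℝ) ^ 2)⁻¹ else 0) := by apply mul_nonneg hK; split_ifs <;> positivity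
    have t4 : 0 ≤ K * (if J < N - v then (((N - v : ℕ) : ℝ) ^ 2)⁻¹ else 0) := by apply mul_nonneg hK; split_ifs <;> positivity
    have hdS : min (v : ℝ) ((N : ℝ) - v) * h ⟨v, hvN⟩ ≤ min (v : ℝ) ((N : ℝ) - v) * S := mul_le_mul_of_nonneg_left hhS hm0
    by_cases hvJ : v ≤ J
    · have : min (v : ℝ) ((N : ℝ) - v) * S ≤ (v : ℝ) * S := mul_le_mul_of_nonneg_right hmv hS
      simp only [hb, if_pos hvJ]; linarith
    by_cases hvJ' : N ≤ v + J
    · have : min (v : ℝ) ((N : ℝ) - v) * S ≤ ((N - v : ℕ) : ℝ) * S := by rw [hNv]; exact mul_le_mul_of_nonneg_right hmN hS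
      simp only [hb, if_pos hvJ']; linarith
    push Not at hvJ hvJ'
    have hv0 : v ≠ 0 := by omega
    have hd := hdec ⟨v, hvN⟩ (by simpa using hv0)
    by_cases hside : 2 * v ≤ N
    · have hmin : min (v : ℝ) ((N : ℝ) - v) = v := by
        apply min_eq_left; have : ((2 * v : ℕ) : ℝ) ≤ N := by exact_mod_cast hside
        push_cast at this; linarith
      rw [hmin] at hd ⊢
      have hvpos : (0 : ℝ) < (v : ℝ) := by exact_mod_cast Nat.pos_of_ne_zero hv0
      have hq : (v : ℝ) * h ⟨v, hvN⟩ ≤ K * ((v : ℝ) ^ 2)⁻¹ := by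
        rw [← div_eq_mul_inv, le_div_iff₀ (by positivity)]; nlinarith
      simp only [hb, if_pos hvJ]; linarith
    · have hmin : min (v : ℝ) ((N : ℝ) - v) = (N : ℝ) - v := by
        apply min_eq_right; push Not at hside
        have : (N : ℝ) < ((2 * v : ℕ) : ℝ) := by exact_mod_cast hside
        push_cast at this; linarith
      rw [hmin] at hd ⊢
      have hvpos : (0 : ℝ) < (N : ℝ) - v := by linarith
      have hq : ((N : ℝ) - v) * h ⟨v, hvN⟩ ≤ K * (((N - v : ℕ) : ℝ) ^ 2)⁻¹ := by
        rw [hNv, ← div_eq_mul_inv, le_div_iff₀ (by positivity)]; nlinarith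
      have h4 : J < N - v := by omega
      simp only [hb, if_pos h4]; linarith
  refine (Finset.sum_le_sum hpt).trans ?_
  simp only [hb, Finset.sum_add_distrib, ← Finset.mul_sum]
  have hJr : (0 : ℝ) < J := by exact_mod_cast hJ
  -- Gauss: `Σ_{v ≤ J} v = J(J+1)/2`
  have hG : ∑ v ∈ range (J + 1), (v : ℝ) = (J : ℝ) * (J + 1) / 2 := by
    have h := Finset.sum_range_id_mul_two (J + 1)
    rw [Nat.add_sub_cancel] at h
    have h' := congrArg (fun n : ℕ => (n : ℝ)) h
    push_cast at h'
    linarith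
  -- (1) near part, right side
  have s1 : ∑ v ∈ range N, (if v ≤ J then (v : ℝ) * S else 0) ≤ S * ((J : ℝ) * (J + 1) / 2) := by
    have hsub : ∑ v ∈ range N, (if v ≤ J then (v : ℝ) * S else 0) ≤ ∑ v ∈ range (J + 1), (v : ℝ) * S := by
      rw [← Finset.sum_filter]
      refine Finset.sum_le_sum_of_subset_of_nonneg ?_ (fun v _ _ => by positivity)
      intro v hv; simp only [Finset.mem_filter, Finset.mem_range] at hv ⊢; omega
    refine hsub.trans (le_of_eq ?_)
    rw [← Finset.sum_mul, hG]; ring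
  -- (2) near part, left side (reflected)
  have s2 : ∑ v ∈ range N, (if N ≤ v + J then (((N - v : ℕ) : ℝ)) * S else 0) ≤ S * ((J : ℝ) * (J + 1) / 2) := by
    have hrefl : ∑ v ∈ range N, (if N ≤ v + J then (((N - v : ℕ) : ℝ)) * S else 0) =
        ∑ v ∈ range N, (if v + 1 ≤ J then (((v + 1 : ℕ) : ℝ)) * S else 0) := by
      rw [← Finset.sum_range_reflect (fun v => (if v + 1 ≤ J then (((v + 1 : ℕ) : ℝ)) * S else 0)) N]
      refine Finset.sum_congr rfl (fun v hv => ?_)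
      have hvN := Finset.mem_range.mp hv
      have e : N - 1 - v + 1 = N - v := by omega
      simp only [e]
      by_cases hc : N ≤ v + J
      · rw [if_pos hc, if_pos (by omega)]
      · rw [if_neg hc, if_neg (by omega)]
    rw [hrefl]
    have hsub : ∑ v ∈ range N, (if v + 1 ≤ J then (((v + 1 : ℕ) : ℝ)) * S else 0) ≤ ∑ v ∈ range J, (((v + 1 : ℕ) : ℝ)) * S := by
      rw [← Finset.sum_filter]
      refine Finset.sum_le_sum_of_subset_of_nonneg ?_ (fun v _ _ => by positivity)
      intro v hv; simp only [Finset.mem_filter, Finset.mem_range] at hv ⊢; omega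
    refine hsub.trans (le_of_eq ?_)
    have hG' : ∑ v ∈ range J, (((v + 1 : ℕ) : ℝ)) = (J : ℝ) * (J + 1) / 2 := by
      have h := Finset.sum_range_succ' (fun v => (v : ℝ)) J
      push_cast at h ⊢
      rw [hG] at h
      linarith
    rw [← Finset.sum_mul, hG']; ring
  -- (3) the right tail
  have s3 : K * ∑ v ∈ range N, (if J < v then ((v : ℝ) ^ 2)⁻¹ else 0) ≤ K * (1 / J) :=
    mul_le_mul_of_nonneg_left (klct_sum_inv_sq_tail_le hJ N) hK
  -- (4) the left tail, reflected
  have s4 : K * ∑ v ∈ range N, (if J < N - v then (((N - v : ℕ) : ℝ) ^ 2)⁻¹ else 0) ≤ K * (1 / J) := by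
    refine mul_le_mul_of_nonneg_left ?_ hK
    have hrefl : ∑ v ∈ range N, (if J < N - v then (((N - v : ℕ) : ℝ) ^ 2)⁻¹ else 0) =
        ∑ v ∈ range N, (if J < v + 1 then (((v + 1 : ℕ) : ℝ) ^ 2)⁻¹ else 0) := by
      rw [← Finset.sum_range_reflect (fun v => (if J < v + 1 then (((v + 1 : ℕ) : ℝ) ^ 2)⁻¹ else 0)) N]
      refine Finset.sum_congr rfl (fun v hv => ?_)
      have hvN := Finset.mem_range.mp hv
      have : N - 1 - v + 1 = N - v := by omega
      simp only [this]
    rw [hrefl]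
    have hshift : ∑ v ∈ range N, (if J < v + 1 then (((v + 1 : ℕ) : ℝ) ^ 2)⁻¹ else 0) ≤
        ∑ v ∈ range (N + 1), (if J < v then ((v : ℝ) ^ 2)⁻¹ else 0) := by
      rw [Finset.sum_range_succ']
      simp only [show ¬ J < 0 from Nat.not_lt_zero J, if_false, add_zero]
      push_cast
      exact le_rfl
    exact hshift.trans (klct_sum_inv_sq_tail_le hJ (N + 1))
  have htot : S * ((J : ℝ) * (J + 1) / 2) + S * ((J : ℝ) * (J + 1) / 2) + K * (1 / J) + K * (1 / J) = S * (J * (J + 1)) + 2 * K / J := by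
    field_simp; ring
  linarith [s1, s2, s3, s4]

/-! ## §5 The first time moment of the cut leg kernel, β/M-explicitly -/

/-- **THE FIRST TIME MOMENT OF THE CUT LEG KERNEL, β- AND `M`-EXPLICITLY** (`128 ≤ β ≤ M`, any integer `J ≥ 1`):
`(2M)⁻¹ Σ_j (β·min(j, 2M−j)/(2M))·|ĉ(j)| ≤ β·[(β/(8π)+1)·J(J+1) + 2·(C₃(β)(2M)³/64)/J]/(2M)²`,
`C₃(β) = 4K₃(2π/β)³(3β/(64π)+4)` — the physical first moment (time `τ_j = βj/2M`, torus distance) of one cut leg. -/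
theorem klct_legFirstMoment_uvCut_le {β : ℝ} (hβ : 128 ≤ β) (hM : β ≤ M) {J : ℕ} (hJ : 1 ≤ J) :
    (((2 * M : ℕ) : ℝ))⁻¹ * ∑ j : ImagTimeIdx M, (β * min ((j : ℕ) : ℝ) (((2 * M : ℕ) : ℝ) - (j : ℕ)) / ((2 * M : ℕ) : ℝ)) *
        ‖∑ n : MatsubaraIdx M, (((gnScaleCutoff 4 klE0 1 |matsubaraFreq β M n| : ℝ) : ℂ)) *
          Complex.exp (-((2 * Real.pi * ((n : ℕ) : ℝ) * ((j : ℕ) : ℝ) / (2 * M) : ℝ) : ℂ) * Complex.I)‖ ≤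
      β * ((β / (8 * Real.pi) + 1) * ((J : ℝ) * (J + 1)) +
        2 * (4 * ((32 / 3) ^ 3 * 5391) * (2 * Real.pi / β) ^ 3 * (3 * β / (64 * Real.pi) + 4) * ((2 * M : ℕ) : ℝ) ^ 3 / 64) / J) /
        ((2 * M : ℕ) : ℝ) ^ 2 := by
  have hβ0 : 0 < β := by linarith
  have hMne := NeZero.ne M
  have hN : 0 < 2 * M := by omega
  have hNr : (0 : ℝ) < ((2 * M : ℕ) : ℝ) := by exact_mod_cast hN
  set h : ImagTimeIdx M → ℝ := fun j => ‖∑ n : MatsubaraIdx M, (((gnScaleCutoff 4 klE0 1 |matsubaraFreq β M n| : ℝ) : ℂ)) *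
      Complex.exp (-((2 * Real.pi * ((n : ℕ) : ℝ) * ((j : ℕ) : ℝ) / (2 * M) : ℝ) : ℂ) * Complex.I)‖ with hh
  -- `h ≤ S`
  set S : ℝ := β / (8 * Real.pi) + 1 with hS
  have hS0 : 0 ≤ S := by positivity
  have hle : ∀ j, h j ≤ S := by
    intro j
    refine (norm_sum_le _ _).trans ?_
    have : ∀ n : MatsubaraIdx M, ‖(((gnScaleCutoff 4 klE0 1 |matsubaraFreq β M n| : ℝ) : ℂ)) *
        Complex.exp (-((2 * Real.pi * ((n : ℕ) : ℝ) * ((j : ℕ) : ℝ) / (2 * M) : ℝ) : ℂ) * Complex.I)‖ = gnScaleCutoff 4 klE0 1 |matsubaraFreq β M n| := by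
      intro n
      rw [norm_mul, klct_norm_cexp_neg_real_mul_I, mul_one, Complex.norm_real, Real.norm_eq_abs, abs_of_nonneg (klct_uvCutoff_mem_Icc _).1]
    simp_rw [this]
    exact klct_sum_uvCutoff_le hβ0
  -- `h·dist³ ≤ C₃ N³/64`
  set C₃ : ℝ := 4 * ((32 / 3) ^ 3 * 5391) * (2 * Real.pi / β) ^ 3 * (3 * β / (64 * Real.pi) + 4) with hC₃
  have hC₃0 : 0 ≤ C₃ := by positivity
  have hdec : ∀ j : ImagTimeIdx M, ((j : ℕ)) ≠ 0 → h j * (min ((j : ℕ) : ℝ) (((2 * M : ℕ) : ℝ) - (j : ℕ))) ^ 3 ≤ C₃ * ((2 * M : ℕ) : ℝ) ^ 3 / 64 := by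
    intro j _
    have hstep := klct_legTransform_uvCut_cube_decay hβ hM j
    rw [div_pow, mul_div_assoc', div_le_iff₀ (by positivity)] at hstep
    have : h j * (min ((j : ℕ) : ℝ) (((2 * M : ℕ) : ℝ) - (j : ℕ))) ^ 3 * 64 = h j * (4 * min ((j : ℕ) : ℝ) (((2 * M : ℕ) : ℝ) - (j : ℕ))) ^ 3 := by ring
    rw [le_div_iff₀ (by norm_num : (0:ℝ) < 64), this]
    exact hstep
  have hsum := klct_sum_dist_mul_le_of_cube_decay (N := 2 * M) h hS0 (by positivity : 0 ≤ C₃ * ((2 * M : ℕ) : ℝ) ^ 3 / 64) hle hdec hJ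
  -- reshape: pull out `β / N` and divide by `N`
  have hre : ∑ j : ImagTimeIdx M, (β * min ((j : ℕ) : ℝ) (((2 * M : ℕ) : ℝ) - (j : ℕ)) / ((2 * M : ℕ) : ℝ)) * h j =
      β / ((2 * M : ℕ) : ℝ) * ∑ j : ImagTimeIdx M, min ((j : ℕ) : ℝ) (((2 * M : ℕ) : ℝ) - (j : ℕ)) * h j := by
    rw [Finset.mul_sum]
    exact Finset.sum_congr rfl (fun j _ => by ring)
  rw [hre, ← mul_assoc]
  have hcoef : 0 ≤ (((2 * M : ℕ) : ℝ))⁻¹ * (β / ((2 * M : ℕ) : ℝ)) := by positivity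
  refine (mul_le_mul_of_nonneg_left hsum hcoef).trans (le_of_eq ?_)
  field_simp

end Summit.HubbardSuperconductivity.HubbardSuperconductivity.Theorems.KLRegimeSplit

end
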